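import Literature.AlgebraicGeometry.Resolution.PointBlowupShade
import Literature.AlgebraicGeometry.Resolution.PointBlowupShadeCentres

/-!
# [OURS · L1 W4.6] Rung (iii) "Moh window" for the classical pair — the TERMINATION statement under minimal
  coordinate centres, FINITE-WALK FORM (`…TerminalCentreTerminatesFin`): repair of OURS-desk #73

Cell `res-hironaka`, LADDER-RESOLUTION rung L (D-0089), slot W4.6 (restricted regimes as rungs of the typed Th. 16.6
procedure), rung (iii) «purely inseparable `z^p = f` with `ord f < 2p` (Moh window)»; typer res-L1-type-o1 (OURS typer
o1, statement-only lane, G4), typing the ADJUDICATOR'S REPAIR of OURS-desk #73 verbatim. Host route MarkedTransfer,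
`--kind definition --supports stmt-ResolutionOfSingularities-16155 --as helper`. Sibling of res-L1-s46-pv-6's
statement file `MarkedTransferCampaignW46MohWindowShadeExitStatement.lean` (v5 p489429, 11 OURS predicates; NOT imported,
NOT modified): its decl `CampaignW46MohWindowShadeTerminalCentreTerminates` was RULED VACUOUS AS TYPED (res-adj-8
2026-08-27T03:35:00Z, kernel evidence `HOME/ledger/evidence/OURS-73/res-adj-8-Desk73-TerminalCentreTerminates-vacuity.lean`
sha16 d2d49ed5466ae731: its two centre hypotheses «`p ≤ degIn (S n) (s n).r`» and «`degIn ((S n).erase i) (s n).r < p`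
for `i ∈ S n`» are demanded at EVERY `n` along a walk whose `|r n|` strictly decreases, which is unsatisfiable, so the
decl holds by `False.elim`). THE REPAIR (ruling, = lane B's FIX 03:20:40Z): quantify those two hypotheses over `n < N`,
after `∀ N`, exactly as the sibling `CampaignW46MohWindowShadeAntitoneFin` does for its walk hypotheses. That is the ONE
predicate below; everything else (vocabulary, role, window) is pv-6's, unchanged.

Vocabulary (tree, `Literature/AlgebraicGeometry/Resolution/PointBlowupShade*.lean`, the typed model of [Hauser2010,
§§F–G] / [HauserPerlega2019PRIMS, §2]): a coordinate-centre state `s : CentreBlowup.CState σ K` of `x^p + F(y)` (`F` the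
residual polynomial, `y^r` the exceptional monomial), `CentreBlowup.step p S j b s` the blow-up along the coordinate
centre `C_S` read in the chart `y_j` at the point `b`, `CentreBlowup.degIn S r = Σ_{i ∈ S} r_i`,
`CentreBlowup.IsEquimultiplePoint`, `deletePthPowers` (cleaning), `ordZero` (order at the origin).

VACUITY / STRENGTH SELF-CHECK (typer): NOT trivially true — for `N = 0` the three `n < N` hypotheses are empty and the
conclusion `0 + p ≤ |r₀|` is the window hypothesis `p < |r₀|` (degenerate slice, disclosed), and for `N ≥ 1` the antecedent
only constrains the first `N` centres and points of an actual walk (minimal permissible coordinate centres, equimultiple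
points) — data conditions not excluded by the other hypotheses: #73's contradiction (adjudication file, (i)) needed the
centre hypothesis «`p ≤ degIn (S n) (s n).r ≤ |r n|`» at EVERY `n` against the strictly decreasing `|r n|`, i.e. at
indices `n > |r₀| − p` that the repaired statement never reaches (its conclusion is precisely `N ≤ |r₀| − p`). No kernel
instance of the antecedent with `N ≥ 1` is supplied here (typer's hand reading; a lane wanting one may ask for a
`decide` certificate in the style of pv-6's `…ShadeExitCert.lean`). NOT trivially false — closed by the Fin-variant of pv-6's
`MohWindowShadeTerminalCentresExit.length_le_of_minimalCentres` (which invokes the centre hypotheses only at `n < N`),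
filed separately as a kind-proof companion. Candidates not facts; nothing of H. Hironaka's manuscript
[claim: Hironaka2017, status: under-review] is used or asserted; the role named is the one the predicate REPLACES in
regime (iii), it is NOT a statement of the manuscript. AI-written; AI review is weaker than expert review.
-/

noncomputable section

set_option linter.dupNamespace false -- mandated namespace of this single-conjunct summit

namespace Summit.ResolutionOfSingularities.ResolutionOfSingularities.Theorems

open Literature.AlgebraicGeometry.Resolution
open Literature.AlgebraicGeometry.Resolution.Hauser2010

/-- [OURS · L1 W4.6] replaces the role of the termination clause of Th. 16.13, ms. p. 87 l. 25–29, in regime (iii) for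
the classical pair in the TERMINAL CASE under MINIMAL permissible coordinate centres, every dimension — FINITE-WALK
FORM (repair of OURS-desk #73; SUPERSEDES THE ROLE of the vacuous `CampaignW46MohWindowShadeTerminalCentreTerminates`):
along any walk `s_{n+1} = CentreBlowup.step p (S n) (j n) (b n) (s n)` with `j n ∈ S n` and points over the origin
(`b n (j n) = 0`, `b n i = 0` off `S n`), from a cleaned coordinate-monomial state inside the window
(`deletePthPowers p F₀ = F₀`, `y^{r₀} ∣ F₀`, `ord₀ F₀ = |r₀|`, `p < |r₀| < 2p`): for every `N`, if the FIRST `N` centres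
are permissible and minimal (`Σ_{S n} r_n ≥ p` and `Σ_{S n ∖ {i}} r_n < p` for `i ∈ S n`, for `n < N`) and the first `N`
points are equimultiple, then `N + p ≤ |r₀|` («the combinatorial resolution process terminates in finitely many
steps», [HauserPerlega2024, §3 (2)], in the model). Differs from the #73 decl ONLY in that the two centre hypotheses
are asked for `n < N` (after `∀ N`) instead of for all `n` — as `CampaignW46MohWindowShadeAntitoneFin` does. NOT a
statement of the manuscript. -/
def CampaignW46MohWindowShadeTerminalCentreTerminatesFin (p : ℕ) (K : Type*) [Field K] [DecidableEq K]
    [CharP K p] (σ : Type*) [Fintype σ] [DecidableEq σ] : Prop :=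
  ∀ (s : ℕ → CentreBlowup.CState σ K) (S : ℕ → Finset σ) (j : ℕ → σ) (b : ℕ → σ → K),
    (∀ n, j n ∈ S n) → (∀ n, b n (j n) = 0) → (∀ n i, i ∉ S n → b n i = 0) →
    (∀ n, s (n + 1) = CentreBlowup.step p (S n) (j n) (b n) (s n)) →
    deletePthPowers p (s 0).F = (s 0).F → (∀ d ∈ (s 0).F.support, (s 0).r ≤ d) →
    ordZero (s 0).F = ((s 0).r.degree : ℕ) → p < (s 0).r.degree → (s 0).r.degree < 2 * p →
    ∀ N : ℕ, (∀ n, n < N → p ≤ CentreBlowup.degIn (S n) (s n).r) →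
    (∀ n, n < N → ∀ i ∈ S n, CentreBlowup.degIn ((S n).erase i) (s n).r < p) →
    (∀ n, n < N → CentreBlowup.IsEquimultiplePoint p (S n) (j n) (b n) (s n)) →
    N + p ≤ (s 0).r.degree

end Summit.ResolutionOfSingularities.ResolutionOfSingularities.Theorems

end
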